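import Summits.QuantumFields.YangMills.Theorems.LocalInsertionSublevelDoublingCone
import Summits.QuantumFields.YangMills.Theorems.LocalInsertionSublevelDoublingSliceLoc
import Summits.QuantumFields.YangMills.Theorems.LocalInsertionSublevelDoublingSliceOpen
import Summits.QuantumFields.YangMills.Theorems.LangevinControlUVFemtoCurvatureTwoPointCStubHaarCoLipschitz
import Summits.QuantumFields.YangMills.Theorems.LocalInsertionTorusUpperAxisD3Prep
import Literature.MathematicalPhysics.QuantumFieldTheory.WilsonEnergyConvexity
import HarnessLib

/-!
# Sublevel doubling of Wilson's action on `(ℤ/L)^d`, every `d` — the COVER: doubling of the sublevel volumes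

Crux `HistoryTailL` (stmt-QuantumFields-19936), level-0 lane (T4) «uniform doubling», row (T4-SUB), file 8: the `{d : ℕ}`-generic port
(literal `4 ↦ d`, proof verbatim) of `Theorems/LangevinControlUVFemtoCurvatureTwoPointCDoublingCover.lean` +
`…CDoublingSublevel.lean` (route `LangevinControlUV`, crux `FemtoCurvatureTwoPointC`, line `Sketch` v7, file P6 and the lead's
`stub_sublevelDoubling`). From the CONE (`exists_cone`), the local co-Lipschitz estimate of the gauge-tube chart (LOC, `sliceLoc`), the
openness of the small gauge tube (OPEN, `sliceOpen`) and the Hausdorff-type scaling of Haar measure under co-Lipschitz maps (landed,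
d-free `stub_haarCoLipschitz`), the doubling `Haar^E{S ≤ t} ≤ K · Haar^E{S ≤ t/4}` for `0 < t ≤ t₀` on EVERY fixed torus `(ℤ/L)^d`,
every `d`: finitely many tubes cover a neighbourhood of the compact flat set (hence a sublevel set `{S ≤ t₀}`), and on each tube the
scaling map `h · cfg τ A ↦ h · cfg τ (s • A)` shrinks the action by `K s²` (cone + gauge invariance) while expanding Frobenius distances
by at most `K/s` (LOC). The one-site instance `d = 3`, `L = 1` is the input of the one-site partition-function doubling behind the
γ-uniform level-0 plaquette moment of the cell `ym3-torus` (rung R3: continuum SU(2) YM₃ on T³ — not infinite volume, not a mass gap,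
not Clay). Everything here is proved; no definitions.
-/

set_option autoImplicit false

noncomputable section

open scoped Matrix Matrix.Norms.Frobenius InnerProductSpace ENNReal NNReal
open NormedSpace MeasureTheory Filter Topology
open Literature.MathematicalPhysics.QuantumLattice Literature.MathematicalPhysics.QuantumFieldTheory
open Summit.QuantumFields.YangMills.Theorems.FreeEnergyLogCoefficient
open Summit.QuantumFields.YangMills.Theorems.FemtoCurvatureTwoPointC.Doubling (Fib adFib lieIso_adFib adFib_mul adFib_one
  adFib_inv_apply adFib_apply_inv inner_adFib rho_inv_mul rho_mul_inv rho_matrix_inv isUnit_rho conjTranspose_rho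
  rho_inv_conj_conj exp_lieIso_adFib exp_neg_lieIso_adFib expChart_adFib rho_expChart_inv sub_re_trace_eq_norm_sq
  re_trace_conjTranspose_conj_mul norm_rho_inv_sub_one)

namespace Summit.QuantumFields.YangMills.Theorems.LocalInsertion.SublevelDoubling

/-! ### Topological preliminaries on the configuration space -/

section Prelim

variable {G : Type} [Group G] [TopologicalSpace G] [IsTopologicalGroup G] {d L : ℕ}

/-- The flat set is closed. -/
theorem isClosed_flat [T1Space G] :
    IsClosed {U : GaugeConfig d L G | ∀ (x : Site d L) (i j : Fin d), plaquetteHolonomy U x i j = 1} := by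
  have h : {U : GaugeConfig d L G | ∀ (x : Site d L) (i j : Fin d), plaquetteHolonomy U x i j = 1} =
      ⋂ x : Site d L, ⋂ i : Fin d, ⋂ j : Fin d, {U | plaquetteHolonomy U x i j = 1} := by
    ext U; simp
  rw [h]
  exact isClosed_iInter fun x => isClosed_iInter fun i => isClosed_iInter fun j =>
    isClosed_eq (by unfold plaquetteHolonomy; fun_prop) continuous_const

end Prelim

variable {G : Type} [Group G] [TopologicalSpace G] [CompactSpace G] (r : LatticeRep G) {d L : ℕ}

omit [CompactSpace G] in
/-- **Zero action means flat** (faithful representation). -/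
theorem flat_of_wilsonAction_eq_zero [NeZero L] {U : GaugeConfig d L G} (hU : wilsonAction r.ρ U = 0)
    (x : Site d L) (i j : Fin d) : plaquetteHolonomy U x i j = 1 := by
  rw [wilsonAction_eq_quarter_sum r U] at hU
  have hsum : ∑ x : Site d L, ∑ i : Fin d, ∑ j : Fin d, ‖r.ρ (plaquetteHolonomy U x i j) - 1‖ ^ 2 = 0 := by
    rcases div_eq_zero_iff.1 hU with h | h
    · exact h
    · norm_num at h
  have hx := (Finset.sum_eq_zero_iff_of_nonneg (fun x _ => Finset.sum_nonneg fun i _ => Finset.sum_nonneg fun j _ =>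
    sq_nonneg _)).1 hsum x (Finset.mem_univ x)
  have hi := (Finset.sum_eq_zero_iff_of_nonneg (fun i _ => Finset.sum_nonneg fun j _ => sq_nonneg _)).1 hx i
    (Finset.mem_univ i)
  have hj := (Finset.sum_eq_zero_iff_of_nonneg (fun j _ => sq_nonneg _)).1 hi j (Finset.mem_univ j)
  have h0 : r.ρ (plaquetteHolonomy U x i j) - 1 = 0 := norm_eq_zero.1 ((pow_eq_zero_iff two_ne_zero).1 hj)
  exact r.injective (by rw [map_one]; exact sub_eq_zero.1 h0)

omit [CompactSpace G] in
/-- The Wilson action of a unitary representation is non-negative (quarter sum of squares). -/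
theorem wilsonAction_nonneg' [NeZero L] (U : GaugeConfig d L G) : 0 ≤ wilsonAction r.ρ U := by
  rw [wilsonAction_eq_quarter_sum r U]
  positivity

/-! ### The assembly -/

/-- **SUBLEVEL DOUBLING of Wilson's action on every fixed torus `(ℤ/L)^d`, every dimension `d`.** For every compact group `G`
(any Borel structure), every lattice representation `r` (faithful, unitary, continuous) and every `d`, `L ≥ 1` there are `K` and
`t₀ > 0` with

  `Haar^{E}{U | S(U) ≤ t} ≤ K · Haar^{E}{U | S(U) ≤ t/4}`  for all `0 < t ≤ t₀`,

`S = wilsonAction r.ρ`, `Haar^E` the product of the Haar probability measures over the edges of `(ℤ/L)^d`. Assembled from the CONE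
(`exists_cone`), LOC (`sliceLoc`), OPEN (`sliceOpen`) and the Hausdorff-type scaling of Haar measure under co-Lipschitz maps
(`stub_haarCoLipschitz`, landed, d-free): finitely many gauge tubes cover a neighbourhood of the compact flat set (hence a sublevel
set `{S ≤ t₀}`), and on each tube the scaling map `h · cfg τ A ↦ h · cfg τ (s • A)` shrinks the action by `K s²` (cone + gauge
invariance) while expanding Frobenius distances by at most `K/s` (LOC). The flat set is conical in exponential gauge slices at
EVERY flat configuration, regular or not — no resolution of singularities, no log-canonical threshold. (The d = 4 literal version
is `FemtoCurvatureTwoPointC.stub_sublevelDoubling`.) -/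
theorem sublevelDoubling (G : Type) [Group G] [TopologicalSpace G] [IsTopologicalGroup G] [CompactSpace G] [MeasurableSpace G]
    [BorelSpace G] (r : LatticeRep G) (d L : ℕ) [NeZero L] :
    ∃ (K : ℝ≥0) (t₀ : ℝ), 0 < t₀ ∧ ∀ t : ℝ, 0 < t → t ≤ t₀ →
      Measure.pi (fun _ : Edge d L => haarProbability G) {U : GaugeConfig d L G | wilsonAction r.ρ U ≤ t} ≤
        K * Measure.pi (fun _ : Edge d L => haarProbability G) {U : GaugeConfig d L G | wilsonAction r.ρ U ≤ t / 4} := by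
  have hhaar := Summit.QuantumFields.YangMills.Theorems.FemtoCurvatureTwoPointC.stub_haarCoLipschitz
  haveI : SecondCountableTopology G := (r.continuous.isClosedEmbedding r.injective).isEmbedding.secondCountableTopology
  -- notation
  set μ : Measure (GaugeConfig d L G) := Measure.pi (fun _ : Edge d L => haarProbability G) with hμ
  set S : GaugeConfig d L G → ℝ := fun U => wilsonAction r.ρ U with hSdef
  have hScont : Continuous S := continuous_wilsonAction_of_continuous (d := d) (L := L) r.ρ r.continuous
  -- the flat set and the local data at each flat configuration
  set F : Set (GaugeConfig d L G) := {U | ∀ (x : Site d L) (i j : Fin d), plaquetteHolonomy U x i j = 1} with hFdef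
  haveI : T1Space G := by
    haveI : T2Space G := (r.continuous.isClosedEmbedding r.injective).isEmbedding.t2Space
    infer_instance
  have hFc : IsCompact F := (isClosed_flat (G := G) (L := L)).isCompact
  -- Haar scaling constants (uniform in the flat point)
  obtain ⟨D, C, hD, hH⟩ := hhaar G r.N r.ρ r.continuous r.injective r.mem_unitary (Edge d L)
  -- local data: for τ ∈ F, cone constants, loc constants, an open tube neighbourhood
  have hdata : ∀ τ ∈ F, ∃ (δ Kc Kl : ℝ) (O : Set (GaugeConfig d L G)), 0 < δ ∧ 0 < Kc ∧ 0 < Kl ∧ IsOpen O ∧ τ ∈ O ∧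
      (∀ A ∈ slice r τ, ‖A‖ ≤ δ → ∀ s : ℝ, 0 ≤ s → s ≤ 1 →
        wilsonAction r.ρ (cfg r τ (s • A)) ≤ Kc * s ^ 2 * wilsonAction r.ρ (cfg r τ A)) ∧
      (∀ (η η' : SiteFun r d L) (A A' : OneForm r d L), η ∈ (zeroModes r τ)ᗮ → η' ∈ (zeroModes r τ)ᗮ → A ∈ slice r τ →
        A' ∈ slice r τ → ‖η‖ < δ → ‖η'‖ < δ → ‖A‖ < δ → ‖A'‖ < δ → ∀ s : ℝ, 0 < s → s ≤ 1 →
        s * ‖(fun e : Edge d L => r.ρ (gaugeTransform (gaugeExp r η) (cfg r τ A) e) -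
            r.ρ (gaugeTransform (gaugeExp r η') (cfg r τ A') e))‖ ≤
          Kl * ‖(fun e : Edge d L => r.ρ (gaugeTransform (gaugeExp r η) (cfg r τ (s • A)) e) -
            r.ρ (gaugeTransform (gaugeExp r η') (cfg r τ (s • A')) e))‖) ∧
      (∀ U ∈ O, ∃ (η : SiteFun r d L) (A : OneForm r d L), η ∈ (zeroModes r τ)ᗮ ∧ A ∈ slice r τ ∧ ‖η‖ < δ ∧ ‖A‖ < δ ∧
        U = gaugeTransform (gaugeExp r η) (cfg r τ A)) := by
    intro τ hτ
    obtain ⟨δc, Kc, hδc, hKc, hcone⟩ := exists_cone r hτ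
    obtain ⟨δl, Kl, hδl, hKl, hl⟩ := sliceLoc r τ
    set δ : ℝ := min δc δl with hδ
    have hδ0 : 0 < δ := lt_min hδc hδl
    obtain ⟨O, hO, hτO, hrep⟩ := sliceOpen r τ δ hδ0
    refine ⟨δ, Kc, Kl, O, hδ0, hKc, hKl, hO, hτO, ?_, ?_, hrep⟩
    · intro A hA hAδ s hs0 hs1
      exact hcone A hA (hAδ.trans (min_le_left _ _)) s hs0 hs1
    · intro η η' A A' hη hη' hA hA' nη nη' nA nA' s hs0 hs1
      exact hl η η' A A' hη hη' hA hA' (nη.trans_le (min_le_right _ _)) (nη'.trans_le (min_le_right _ _))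
        (nA.trans_le (min_le_right _ _)) (nA'.trans_le (min_le_right _ _)) s hs0 hs1
  choose! δ Kc Kl O hδ hKc hKl hO hτO hcone hl hrep using hdata
  -- finite subcover of the compact flat set
  obtain ⟨ι, hcover⟩ := hFc.elim_finite_subcover (fun τ : F => O τ) (fun τ => hO τ τ.2)
    (fun U hU => Set.mem_iUnion.2 ⟨⟨U, hU⟩, hτO U hU⟩)
  -- a positive threshold `t₀` with `{S ≤ t₀} ⊆ ⋃ O`
  have ht₀ : ∃ t₀ : ℝ, 0 < t₀ ∧ ∀ U, S U ≤ t₀ → U ∈ ⋃ τ ∈ ι, O (τ : GaugeConfig d L G) := by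
    set Cpl : Set (GaugeConfig d L G) := (⋃ τ ∈ ι, O (τ : GaugeConfig d L G))ᶜ with hCpl
    have hCplc : IsCompact Cpl := by
      refine (IsOpen.isClosed_compl ?_).isCompact
      exact isOpen_biUnion fun τ _ => hO τ τ.2
    rcases Cpl.eq_empty_or_nonempty with hE | hNE
    · refine ⟨1, one_pos, fun U _ => ?_⟩
      by_contra hU
      have : U ∈ Cpl := hU
      rw [hE] at this
      exact this
    · obtain ⟨U₀, hU₀, hmin⟩ := hCplc.exists_isMinOn hNE hScont.continuousOn
      have hpos : 0 < S U₀ := by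
        rcases (wilsonAction_nonneg' r U₀).lt_or_eq with h | h
        · exact h
        · exfalso
          have hflat : U₀ ∈ F := fun x i j => flat_of_wilsonAction_eq_zero r h.symm x i j
          exact hU₀ (hcover hflat)
      refine ⟨S U₀ / 2, by positivity, fun U hU => ?_⟩
      by_contra hUc
      have hUC : U ∈ Cpl := hUc
      have := hmin hUC
      simp only [Set.mem_setOf_eq] at this
      linarith
  obtain ⟨t₀, ht₀pos, ht₀⟩ := ht₀
  -- the common scale `s`
  set Ksum : ℝ := ∑ τ ∈ ι, Kc τ with hKsum
  have hKsum0 : 0 ≤ Ksum := Finset.sum_nonneg fun τ _ => (hKc τ τ.2).le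
  set s : ℝ := (2 * (1 + Ksum))⁻¹ with hsdef
  have hs0 : 0 < s := by positivity
  have hs1 : s ≤ 1 := by
    rw [hsdef]; apply inv_le_one_of_one_le₀; linarith
  have hsK : ∀ τ ∈ ι, Kc τ * s ^ 2 ≤ 1 / 4 := by
    intro τ hτ
    have hK1 : Kc τ ≤ Ksum := Finset.single_le_sum (f := fun τ' : F => Kc τ') (fun τ' _ => (hKc τ' τ'.2).le) hτ
    have h1 : s * (2 * (1 + Ksum)) = 1 := by rw [hsdef]; exact inv_mul_cancel₀ (by positivity)
    have hs2 : s ≤ 1 / 2 := by nlinarith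
    calc Kc τ * s ^ 2 ≤ (1 + Ksum) * s ^ 2 := by gcongr; linarith
      _ = (s * (2 * (1 + Ksum))) * s / 2 := by ring
      _ = s / 2 := by rw [h1]; ring
      _ ≤ 1 / 4 := by linarith
  -- the scaling maps (a representative `(η, A)` is chosen for every point of every tube)
  have hsnn : 0 ≤ s := hs0.le
  choose! ηf Af hηf hAf hnη hnA hUeq using hrep
  set Φ : GaugeConfig d L G → GaugeConfig d L G → GaugeConfig d L G :=
    fun τ U => gaugeTransform (gaugeExp r (ηf τ U)) (cfg r τ (s • Af τ U)) with hΦ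
  -- Borel structure on configurations
  haveI : BorelSpace (GaugeConfig d L G) := Pi.borelSpace
  have hmeasS : ∀ c : ℝ, MeasurableSet {U : GaugeConfig d L G | wilsonAction r.ρ U ≤ c} := fun c =>
    measurableSet_le hScont.measurable measurable_const
  -- the action is gauge invariant along the representatives
  have hSrep : ∀ τ ∈ F, ∀ U ∈ O τ, wilsonAction r.ρ (cfg r τ (Af τ U)) = wilsonAction r.ρ U := by
    intro τ hτ U hU
    have h := congrArg (wilsonAction (d := d) (L := L) r.ρ) (hUeq τ hτ U hU)
    rw [wilsonAction_gaugeTransform] at h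
    exact h.symm
  -- per-tube measure bound
  have htube : ∀ τ ∈ ι, ∀ t : ℝ, 0 < t → t ≤ t₀ →
      μ ({U | wilsonAction r.ρ U ≤ t} ∩ O τ) ≤
        (C : ℝ≥0∞) * (((Kl τ / s).toNNReal : ℝ≥0) : ℝ≥0∞) ^ D * μ {U | wilsonAction r.ρ U ≤ t / 4} := by
    intro τ hτι t ht _htt₀
    have hτF : (τ : GaugeConfig d L G) ∈ F := τ.2
    have hKls : 0 ≤ Kl τ / s := (div_pos (hKl τ hτF) hs0).le
    refine hH (Kl τ / s).toNNReal _ _ ((hmeasS t).inter (hO τ hτF).measurableSet) (hmeasS (t / 4)) (Φ τ) ?_ ?_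
    · -- the scaling map sends `{S ≤ t} ∩ O τ` into `{S ≤ t/4}`
      intro U hU
      obtain ⟨hUt, hUO⟩ := hU
      simp only [Set.mem_setOf_eq] at hUt ⊢
      have hA := hAf τ hτF U hUO
      have hnA' := (hnA τ hτF U hUO).le
      have hS0 : 0 ≤ wilsonAction r.ρ U := wilsonAction_nonneg' r U
      calc wilsonAction r.ρ (Φ τ U) = wilsonAction r.ρ (cfg r τ (s • Af τ U)) := by
            rw [hΦ]; exact wilsonAction_gaugeTransform _ _ _
        _ ≤ Kc τ * s ^ 2 * wilsonAction r.ρ (cfg r τ (Af τ U)) := hcone τ hτF _ hA hnA' s hsnn hs1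
        _ = Kc τ * s ^ 2 * wilsonAction r.ρ U := by rw [hSrep τ hτF U hUO]
        _ ≤ 1 / 4 * wilsonAction r.ρ U := mul_le_mul_of_nonneg_right (hsK τ hτι) hS0
        _ ≤ t / 4 := by linarith
    · -- the scaling map is co-Lipschitz by `Kl/s` on the tube (LOC)
      intro u hu v hv
      obtain ⟨-, huO⟩ := hu
      obtain ⟨-, hvO⟩ := hv
      have hu' : ∀ e, r.ρ (u e) = r.ρ (gaugeTransform (gaugeExp r (ηf τ u)) (cfg r τ (Af τ u)) e) := fun e =>
        congrArg (fun W : GaugeConfig d L G => r.ρ (W e)) (hUeq τ hτF u huO)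
      have hv' : ∀ e, r.ρ (v e) = r.ρ (gaugeTransform (gaugeExp r (ηf τ v)) (cfg r τ (Af τ v)) e) := fun e =>
        congrArg (fun W : GaugeConfig d L G => r.ρ (W e)) (hUeq τ hτF v hvO)
      have hlhs : (fun e : Edge d L => r.ρ (u e) - r.ρ (v e)) = fun e : Edge d L =>
          r.ρ (gaugeTransform (gaugeExp r (ηf τ u)) (cfg r τ (Af τ u)) e) -
            r.ρ (gaugeTransform (gaugeExp r (ηf τ v)) (cfg r τ (Af τ v)) e) := funext fun e => by rw [hu' e, hv' e]
      have key := hl τ hτF (ηf τ u) (ηf τ v) (Af τ u) (Af τ v) (hηf τ hτF u huO) (hηf τ hτF v hvO) (hAf τ hτF u huO)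
        (hAf τ hτF v hvO) (hnη τ hτF u huO) (hnη τ hτF v hvO) (hnA τ hτF u huO) (hnA τ hτF v hvO) s hs0 hs1
      rw [hlhs, Real.coe_toNNReal _ hKls]
      rw [div_mul_eq_mul_div, le_div_iff₀ hs0, mul_comm]
      simpa [hΦ] using key
  -- the constant
  refine ⟨∑ τ ∈ ι, C * (Kl τ / s).toNNReal ^ D, t₀, ht₀pos, fun t ht htt₀ => ?_⟩
  have hsub : {U : GaugeConfig d L G | wilsonAction r.ρ U ≤ t} ⊆
      ⋃ τ ∈ ι, ({U | wilsonAction r.ρ U ≤ t} ∩ O (τ : GaugeConfig d L G)) := by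
    intro U hU
    have hU' : U ∈ ⋃ τ ∈ ι, O (τ : GaugeConfig d L G) := ht₀ U (le_trans hU htt₀)
    simp only [Set.mem_iUnion] at hU' ⊢
    obtain ⟨τ, hτ, hUτ⟩ := hU'
    exact ⟨τ, hτ, hU, hUτ⟩
  calc μ {U : GaugeConfig d L G | wilsonAction r.ρ U ≤ t}
        ≤ μ (⋃ τ ∈ ι, ({U | wilsonAction r.ρ U ≤ t} ∩ O (τ : GaugeConfig d L G))) := measure_mono hsub
    _ ≤ ∑ τ ∈ ι, μ ({U | wilsonAction r.ρ U ≤ t} ∩ O (τ : GaugeConfig d L G)) := measure_biUnion_finset_le _ _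
    _ ≤ ∑ τ ∈ ι, (C : ℝ≥0∞) * (((Kl τ / s).toNNReal : ℝ≥0) : ℝ≥0∞) ^ D * μ {U | wilsonAction r.ρ U ≤ t / 4} :=
        Finset.sum_le_sum fun τ hτ => htube τ hτ t ht htt₀
    _ = (((∑ τ ∈ ι, C * (Kl τ / s).toNNReal ^ D : ℝ≥0)) : ℝ≥0∞) * μ {U | wilsonAction r.ρ U ≤ t / 4} := by
        rw [← Finset.sum_mul, ENNReal.ofNNReal_finsetSum]
        refine congrArg (· * _) (Finset.sum_congr rfl fun τ _ => ?_)
        rw [ENNReal.coe_mul, ENNReal.coe_rpow_of_nonneg _ hD]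

/-! ### The one-site instance in dimension three -/

/-- **One-site sublevel doubling of the commutator cost on `G³` (the `d = 3`, `L = 1` instance).** For every compact group `G`
(any Borel structure) with a lattice representation `r` there are `K` and `t₀ > 0` such that for `0 < t ≤ t₀`

  `Haar^{⊗3}{g | f(g) ≤ t} ≤ K · Haar^{⊗3}{g | f(g) ≤ t/4}`,  `f(g) = Σ_{μ<ν} (N − Re tr r.ρ(g_μ g_ν g_μ⁻¹ g_ν⁻¹))`

(three unordered direction pairs), the three group elements being indexed by the links `(0, μ)` of the one-site torus `(ℤ/1)³`
and `Haar^{⊗3}` the product of the Haar probability measures: `sublevelDoubling G r 3 1` read through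
`TorusUpperAxisD3.OneSiteD3.wilsonAction_eq_commutatorCost` (Wilson's action on `(ℤ/1)³` IS the commutator cost). This is the
displayed sublevel-doubling input of the one-site partition-function doubling `Z₁(b/4) ≤ K'·Z₁(b)` on `G³` behind the γ-uniform
torus doubling `Z_L(b/2) ≤ e^{A L³} Z_L(b)` on `(ℤ/L)³` (the d = 4 twin is `FemtoCurvatureTwoPointC.commutatorCost_sublevelDoubling`). -/
theorem commutatorCost_sublevelDoubling_d3 (G : Type) [Group G] [TopologicalSpace G] [IsTopologicalGroup G] [CompactSpace G]
    [MeasurableSpace G] [BorelSpace G] (r : LatticeRep G) :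
    ∃ (K : ℝ≥0) (t₀ : ℝ), 0 < t₀ ∧ ∀ t : ℝ, 0 < t → t ≤ t₀ →
      Measure.pi (fun _ : Edge 3 1 => haarProbability G)
          {U : GaugeConfig 3 1 G | ∑ q : {q : Fin 3 × Fin 3 // q.1 < q.2},
            ((r.N : ℝ) - (r.ρ (U (0, q.1.1) * U (0, q.1.2) * (U (0, q.1.1))⁻¹ *
              (U (0, q.1.2))⁻¹)).trace.re) ≤ t} ≤
        K * Measure.pi (fun _ : Edge 3 1 => haarProbability G)
          {U : GaugeConfig 3 1 G | ∑ q : {q : Fin 3 × Fin 3 // q.1 < q.2},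
            ((r.N : ℝ) - (r.ρ (U (0, q.1.1) * U (0, q.1.2) * (U (0, q.1.1))⁻¹ *
              (U (0, q.1.2))⁻¹)).trace.re) ≤ t / 4} := by
  obtain ⟨K, t₀, ht₀, h⟩ := sublevelDoubling G r 3 1
  refine ⟨K, t₀, ht₀, fun t ht htt => ?_⟩
  have hset : ∀ s : ℝ, {U : GaugeConfig 3 1 G | ∑ q : {q : Fin 3 × Fin 3 // q.1 < q.2},
      ((r.N : ℝ) - (r.ρ (U (0, q.1.1) * U (0, q.1.2) * (U (0, q.1.1))⁻¹ *
        (U (0, q.1.2))⁻¹)).trace.re) ≤ s} = {U : GaugeConfig 3 1 G | wilsonAction r.ρ U ≤ s} := by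
    intro s
    ext U
    simp only [Set.mem_setOf_eq, TorusUpperAxisD3.OneSiteD3.wilsonAction_eq_commutatorCost]
  rw [hset t, hset (t / 4)]
  exact h t ht htt

end Summit.QuantumFields.YangMills.Theorems.LocalInsertion.SublevelDoubling

end
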